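import Summits.QuantumFields.YangMills.Theorems.BalabanUVNodesK1R8RowsDefs
import Literature.MathematicalPhysics.QuantumFieldTheory.Balaban1983to89.Node00.Record13SepCoPHV

/-!
# Route `BalabanUVNodes` rev 28 (director-ym №210 (δ) NULL-SET SURGERY; plan g85 `D85-REV28`, recipe (δⱽ)): THE K2⁹ CLOSER — `EndpointGivenRunRowsR13SepCoPHV` (support, born closed) HOLDS OUTRIGHT

Cell `ym-nodeO-ideate`, DEFINER seat `ym-nodeO-def-1` (gen 9); `--kind proof --workitem <K2⁹ item>` (precedent: b2b-an4's `…Theorems.BalabanUVNodesK2R8Holds` for K2⁸ stmt-QuantumFields-26908, plan g84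
RUNBOOK op 4).  The item: K2⁸'s text with the VERSION SLOT — at a Stage-13 tuple carrying unity ∧ slots and admissibility and ANY revision `v : Node00.Revision₁₃ F 2 θ h` of the record's
densities (level 0 verbatim, levels ≥ 1 re-chosen `dV`-a.e.), (B) AS PRINTED of the revised datum `Node00.datumOfRecord₁₃SepCoPHV F 2 θ h v`, the RUN ROWS (i) run-wise constant remainder ∕ (iv)
partial-sum floor ∕ (C) survivor continuity of `Node00.betaOfRecord₁₃ F 2 θ.toStage13Params` on SOME level `γ₀ > 0` (bodies inlined in the item text), and the window clause of the revised datum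
⟹ endpoint existence `DagBinding.EndpointExistence (Node00.datumOfRecord₁₃SepCoPHV F 2 θ h v).C.toB12`.  PROOF: END is VERSION-FREE (`Node00.endpointExistence_datumOfRecord₁₃SepCoPHV_iff`, `Iff.rfl`:
`toB12` of the revised datum IS the record's) and at the record it is node n24's END theorem BY NAME (`K1R8RowsDefs.endpointExistence_of_runRowsCont13` = dag-n13-w4's
`…K1WindowKOfRunRowsSurvivors.endpointExistence_datumOfRecord₁₃SepCoPH_of_runRows_survCont`); unity, admissibility, (B), the version and the window are NOT read.

HONEST FRAMING.  This closes a BORN-CLOSED SUPPORT item — a DISPLAY of the rung's END step under the rev-28 shape; it moves NO load-bearing crux (after rev 28 the open cruxes of the cone are K0⁷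
stmt-QuantumFields-20541, K1⁹ (DECIDING; it owes (B) at SOME revision, the window and the rows at its witness) and K3⁸), discharges NO node of the 28, proves NO registered stub, asserts NOTHING of
Bałaban's analysis; counts unmoved by this file; [Balaban1987RG1] Thm 2 + (0.31) p. 259 and §1's continuity (pp. 263–264) are UNPROVED IN PRINT; route R4 closes the CONDITIONAL finite-𝕋⁴ rung
`BalabanLadder.UV` only — ONE kernel implication on ONE finite 𝕋⁴ at fixed ε; NOT the continuum limit, NOT ℝ⁴, NOT OS, NOT the Yang–Mills mass gap, NOT Clay.  No `def`, no `instance`, no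
`notation`, no `axiom`.  Sources (context only): [I] = [Balaban1987RG1] CMP **109** (1987): Thm 2 p. 259 (first sentence), Thm 3 p. 264, (5.10) p. 293, §1 pp. 263–264; [III] =
[Balaban1988Convergent] CMP **119** (1988): (2.18) p. 257, Cor. 3 (2.50) p. 264 (the slot's purpose).
-/

noncomputable section

namespace Summit.QuantumFields.YangMills.Theorems.BalabanUVNodesK2R9Holds

open Literature.MathematicalPhysics.QuantumFieldTheory.Balaban1983to89
open Summit.QuantumFields.YangMills.Theorems.BalabanUVNodesK1R8RowsDefs (endpointExistence_of_runRowsCont13)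

/-- **K2⁹ `EndpointGivenRunRowsR13SepCoPHV` HOLDS** (route `BalabanUVNodes` rev 28, support, born closed): at every version `v` the displayed run rows (i)+(iv)+(C) at one window `γ₀ > 0` give the
endpoint-existence half of [I] Thm 2 for the revised Stage-13 datum — END is version-free (`Node00.endpointExistence_datumOfRecord₁₃SepCoPHV_iff`) and at the record it is node n24's END BY NAME;
unity, admissibility, (B), `v`, the window clause unused.  CLOSES a born-closed SUPPORT item only; K1⁹ owes the rows and the slot letter. [cite: Balaban1987RG1, Thm 2 p.259 (first sentence), Thm 3 p.264 and (5.10) p.293] -/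
theorem endpointGivenRunRowsR13SepCoPHV_holds : Summit.QuantumFields.YangMills.Theses.BalabanUVNodes.EndpointGivenRunRowsR13SepCoPHV := by
  intro F θ h v _ _ _ hrows _
  exact (Node00.endpointExistence_datumOfRecord₁₃SepCoPHV_iff F 2 θ h v).mpr (endpointExistence_of_runRowsCont13 θ h hrows)

end Summit.QuantumFields.YangMills.Theorems.BalabanUVNodesK2R9Holds

end
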